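import Literature.NumberTheory.Automorphic.QuaternionNormOneLatticeApproximation
import Literature.NumberTheory.Automorphic.QuaternionCoordOrderLocalLiftProofs
import Literature.NumberTheory.Automorphic.QuaternionEuclideanEmbedding
import Literature.NumberTheory.Automorphic.QuaternionAlgebraSplitting
import Literature.NumberTheory.Automorphic.QuaternionLocalRamified
import Literature.NumberTheory.Automorphic.MaximalOrderRamifiedPrime
import Literature.NumberTheory.Automorphic.LatticeLocalGlobal
import Mathlib.NumberTheory.Padics.HeightOneSpectrum
import HarnessLib

/-!
# Norm-one points of a lattice in an indefinite quaternion algebra over `ℚ`: the local–global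
# principle

Topic `NumberTheory/Automorphic`; theorems only (no definition, no named fact, no instance).
Let `H = ℍ[ℚ,a,b]` (`a, b ∈ ℤ ∖ 0`) be indefinite and `Λ ⊂ H` a full `ℤ`-lattice. If for every
prime `p` the localisation `Λ₍ₚ₎` contains an element `z` whose norm `z z̄ = 1 + 8d` is a
`p`-adic unit `p`-adically close to `1` (`|d|_p < 1`), then `Λ` contains an element of norm
exactly `1` (`QuaternionAlgebra.exists_mem_mul_star_eq_one`). This is the lattice form of
Kneser's strong approximation theorem for `H¹` (Vignéras, LNM 800, Ch. III §4 Thm. 4.3) used in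
Eichler's proof that locally principal ideals of Eichler orders in indefinite quaternion algebras
over `ℚ` are principal (Vignéras III §5 Cor. 5.7): rescale `z` by a `p`-adic square root of
`1 + 8d` (Hensel) to get norm-one points of `Λ_p` at the finitely many relevant `p`, and
approximate them simultaneously (`exists_mul_star_eq_one_forall_linear_mem`, the linear forms
being the coordinate functionals of a `ℤ`-basis of `Λ`).

Ingredients proved here, all elementary:
* `exists_sq_eq_one_add_eight_mul` — in a Henselian local ring, `1 + 8d` (`d ∈ 𝔪`) is a square
  (the root `Z ≡ 0` of `Z² + Z - 2d`, `s = 1 + 2Z`; works uniformly at `p = 2`);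
* `mem_iff_forall_exists_intCast_eq_repr`, `mem_localAt_iff_forall_padicNorm_repr_le` —
  membership in a lattice `L` (resp. in `L₍ₚ₎`) in terms of the coordinates in a `ℤ`-basis of `L`
  (integral, resp. `p`-integral coordinates);
* `algebraMap_mem_adicCompletionIntegers_iff`, `algebraMap_mem_maximalIdeal_of_padicNorm_lt` —
  a rational number lies in `𝒪_v ⊂ ℚ_v` (resp. `𝔪_v`) iff its `p_v`-adic norm is `≤ 1`
  (resp. if `< 1`), via Mathlib's `adicCompletion.padicEquiv`.

## References

* M.-F. Vignéras, *Arithmétique des algèbres de quaternions*, LNM 800 (1980), Ch. II §1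
  Lemme 1.10, Ch. III §4 Thm. 4.3, §5 Cor. 5.7 [VignerasLNM800].
-/

open NumberField IsDedekindDomain Polynomial

namespace Literature.NumberTheory.Automorphic

/-! ### Hensel: `1 + 8d` is a square -/

/-- **`1 + 8d` is a square in a Henselian local ring when `d ∈ 𝔪`** (uniformly in the residue
characteristic, including `2`): `Z² + Z - 2d` has the simple root `Z ≡ 0 (mod 𝔪)` and
`(1 + 2Z)² = 1 + 4(Z² + Z) = 1 + 8d`. [cite: VignerasLNM800, Ch. II §1 Lemme 1.10] -/
theorem exists_sq_eq_one_add_eight_mul {S : Type*} [CommRing S] [HenselianLocalRing S] {d : S}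
    (hd : d ∈ IsLocalRing.maximalIdeal S) : ∃ s : S, s ^ 2 = 1 + 8 * d := by
  set f : S[X] := X ^ 2 + X - C (2 * d) with hf
  have hmonic : f.Monic := by
    have h : f = X ^ 2 + (X - C (2 * d)) := by rw [hf]; ring
    rw [h]
    refine (monic_X_pow 2).add_of_left ?_
    rw [degree_X_pow]
    exact (degree_X_sub_C _).trans_lt (by norm_num)
  have h0 : f.eval 0 ∈ IsLocalRing.maximalIdeal S := by
    have h : f.eval 0 = -(2 * d) := by rw [hf]; simp
    rw [h]
    exact neg_mem (Ideal.mul_mem_left _ _ hd)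
  have h1 : IsUnit (f.derivative.eval 0) := by
    have h : f.derivative.eval 0 = 1 := by rw [hf]; simp
    rw [h]; exact isUnit_one
  obtain ⟨Z, hZ, -⟩ := HenselianLocalRing.is_henselian f hmonic 0 h0 h1
  have hZ' : Z ^ 2 + Z - 2 * d = 0 := by
    have h := hZ.eq_zero
    rwa [hf, eval_sub, eval_add, eval_pow, eval_X, eval_C] at h
  exact ⟨1 + 2 * Z, by linear_combination 4 * hZ'⟩

/-! ### Coordinates in a `ℤ`-basis of a lattice -/

section Coordinates

variable {V : Type*} [AddCommGroup V] [Module ℚ V] {ι : Type*} [Fintype ι]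

/-- **Membership in a lattice via coordinates**: if a `ℤ`-basis `bZ` of `L` is also a `ℚ`-basis
`bQ` of `V`, then `x ∈ L` iff all `bQ`-coordinates of `x` are integers. [folklore] -/
theorem mem_iff_forall_exists_intCast_eq_repr {L : Submodule ℤ V} (bZ : Module.Basis ι ℤ L)
    (bQ : Module.Basis ι ℚ V) (h : ∀ i, bQ i = (bZ i : V)) (x : V) :
    x ∈ L ↔ ∀ i, ∃ m : ℤ, (m : ℚ) = bQ.repr x i := by
  constructor
  · intro hx i
    refine ⟨bZ.repr ⟨x, hx⟩ i, ?_⟩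
    have hsum : x = ∑ i, ((bZ.repr ⟨x, hx⟩ i : ℤ) : ℚ) • bQ i := by
      conv_lhs => rw [show x = ((⟨x, hx⟩ : L) : V) from rfl, ← bZ.sum_repr ⟨x, hx⟩]
      rw [Submodule.coe_sum]
      refine Finset.sum_congr rfl fun i _ => ?_
      rw [Submodule.coe_smul, h i, Int.cast_smul_eq_zsmul]
    have key : bQ.equivFun x = fun i => ((bZ.repr ⟨x, hx⟩ i : ℤ) : ℚ) := by
      rw [congrArg bQ.equivFun hsum, ← bQ.equivFun_symm_apply, LinearEquiv.apply_symm_apply]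
    have hi := congrFun key i
    rw [Module.Basis.equivFun_apply] at hi
    exact hi.symm
  · intro hx
    choose m hm using hx
    rw [← bQ.sum_repr x]
    refine Submodule.sum_mem _ fun i _ => ?_
    rw [← hm i, h i, Int.cast_smul_eq_zsmul]
    exact Submodule.smul_mem _ _ (bZ i).2

/-- **Membership in a localised lattice via coordinates**: with `bZ, bQ` as above and `p` prime,
`x ∈ L₍ₚ₎` iff all `bQ`-coordinates of `x` are `p`-integral rationals. [folklore] -/
theorem mem_localAt_iff_forall_padicNorm_repr_le {L : Submodule ℤ V} (bZ : Module.Basis ι ℤ L)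
    (bQ : Module.Basis ι ℚ V) (h : ∀ i, bQ i = (bZ i : V)) {p : ℕ} (hp : p.Prime) (x : V) :
    x ∈ localAt p L ↔ ∀ i, padicNorm p (bQ.repr x i) ≤ 1 := by
  haveI : Fact p.Prime := ⟨hp⟩
  constructor
  · rintro ⟨c, hc0, hcp, hcx⟩ i
    obtain ⟨m, hm⟩ := (mem_iff_forall_exists_intCast_eq_repr bZ bQ h _).mp hcx i
    rw [map_zsmul, Finsupp.smul_apply, zsmul_eq_mul, Int.cast_natCast] at hm
    have hc1 : padicNorm p (c : ℚ) = 1 := (padicNorm.nat_eq_one_iff c).mpr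
      (fun hdvd => hp.one_lt.ne' (Nat.Coprime.eq_one_of_dvd hcp.symm hdvd))
    have hle : padicNorm p ((c : ℚ) * bQ.repr x i) ≤ 1 := by rw [← hm]; exact padicNorm.of_int m
    rwa [padicNorm.mul, hc1, one_mul] at hle
  · intro hx
    have hden : ∀ i, ¬ p ∣ (bQ.repr x i).den := fun i => by
      rw [← Padic.norm_ratCast_le_one_iff (p := p), Padic.eq_padicNorm]; exact_mod_cast hx i
    refine ⟨∏ i, (bQ.repr x i).den, Finset.prod_ne_zero_iff.mpr fun i _ => (bQ.repr x i).den_nz,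
      Nat.Coprime.prod_left fun i _ => (Nat.coprime_comm.mp ((Nat.Prime.coprime_iff_not_dvd hp).mpr (hden i))), ?_⟩
    refine (mem_iff_forall_exists_intCast_eq_repr bZ bQ h _).mpr fun i => ?_
    obtain ⟨k, hk⟩ : (bQ.repr x i).den ∣ ∏ i, (bQ.repr x i).den := Finset.dvd_prod_of_mem _ (Finset.mem_univ i)
    refine ⟨k * (bQ.repr x i).num, ?_⟩
    rw [map_zsmul, Finsupp.smul_apply, zsmul_eq_mul, Int.cast_natCast, hk]
    push_cast
    rw [mul_comm ((bQ.repr x i).den : ℚ) (k : ℚ), mul_assoc, Rat.den_mul_eq_num]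

end Coordinates

/-! ### Rational numbers in the completions of `ℚ` -/

section RatPlaces

variable (v : HeightOneSpectrum (𝓞 ℚ))

/-- **A rational number is `v`-integral iff its `p_v`-adic norm is `≤ 1`** (`p_v` the prime under
`v`; Mathlib `adicCompletion.padicEquiv`). [folklore] -/
theorem algebraMap_mem_adicCompletionIntegers_iff (q : ℚ) :
    algebraMap ℚ (v.adicCompletion ℚ) q ∈ v.adicCompletionIntegers ℚ ↔
      padicNorm ((Rat.HeightOneSpectrum.primesEquiv v : Nat.Primes) : ℕ) q ≤ 1 := by
  haveI : Fact ((Rat.HeightOneSpectrum.primesEquiv v : Nat.Primes) : ℕ).Prime :=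
    ⟨(Rat.HeightOneSpectrum.primesEquiv v).2⟩
  have hbij := Rat.HeightOneSpectrum.adicCompletion.padicEquiv_bijOn (R := 𝓞 ℚ) v
  have hEq : Rat.HeightOneSpectrum.adicCompletion.padicEquiv v (algebraMap ℚ (v.adicCompletion ℚ) q) =
      ((q : ℚ) : ℚ_[(Rat.HeightOneSpectrum.primesEquiv v : Nat.Primes)]) :=
    (Rat.HeightOneSpectrum.adicCompletion.padicEquiv v).commutes q
  have hnorm : ‖((q : ℚ) : ℚ_[(Rat.HeightOneSpectrum.primesEquiv v : Nat.Primes)])‖ ≤ 1 ↔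
      padicNorm ((Rat.HeightOneSpectrum.primesEquiv v : Nat.Primes) : ℕ) q ≤ 1 := by
    rw [Padic.eq_padicNorm]; exact_mod_cast Iff.rfl
  rw [← hnorm, ← PadicInt.mem_subring_iff, ← hEq]
  constructor
  · exact fun hq => hbij.mapsTo hq
  · intro hq
    rw [← SetLike.mem_coe, ← hbij.image_eq] at hq
    obtain ⟨x, hx, hxe⟩ := hq
    rwa [← (Rat.HeightOneSpectrum.adicCompletion.padicEquiv v).injective hxe]

/-- **A rational number with `p_v`-adic norm `< 1` lies in `𝔪_v`.** [folklore] -/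
theorem algebraMap_mem_maximalIdeal_of_padicNorm_lt (q : ℚ)
    (hq : padicNorm ((Rat.HeightOneSpectrum.primesEquiv v : Nat.Primes) : ℕ) q < 1) :
    ∃ h : algebraMap ℚ (v.adicCompletion ℚ) q ∈ v.adicCompletionIntegers ℚ,
      (⟨algebraMap ℚ (v.adicCompletion ℚ) q, h⟩ : v.adicCompletionIntegers ℚ) ∈
        IsLocalRing.maximalIdeal (v.adicCompletionIntegers ℚ) := by
  haveI : Fact ((Rat.HeightOneSpectrum.primesEquiv v : Nat.Primes) : ℕ).Prime :=
    ⟨(Rat.HeightOneSpectrum.primesEquiv v).2⟩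
  have hmem := (algebraMap_mem_adicCompletionIntegers_iff v q).mpr hq.le
  refine ⟨hmem, ?_⟩
  rw [IsLocalRing.mem_maximalIdeal, mem_nonunits_iff]
  intro hu
  have hu' := hu.map (Rat.HeightOneSpectrum.adicCompletionIntegers.padicIntEquiv (R := 𝓞 ℚ) v)
  rw [PadicInt.isUnit_iff] at hu'
  have hEq : ((Rat.HeightOneSpectrum.adicCompletionIntegers.padicIntEquiv (R := 𝓞 ℚ) v
      ⟨algebraMap ℚ (v.adicCompletion ℚ) q, hmem⟩ :
        ℤ_[(Rat.HeightOneSpectrum.primesEquiv v : Nat.Primes)]) :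
        ℚ_[(Rat.HeightOneSpectrum.primesEquiv v : Nat.Primes)]) =
      ((q : ℚ) : ℚ_[(Rat.HeightOneSpectrum.primesEquiv v : Nat.Primes)]) := by
    rw [Rat.HeightOneSpectrum.adicCompletionIntegers.coe_padicIntEquiv_apply]
    exact (Rat.HeightOneSpectrum.adicCompletion.padicEquiv v).commutes q
  rw [PadicInt.norm_def, hEq, Padic.eq_padicNorm] at hu'
  have : padicNorm ((Rat.HeightOneSpectrum.primesEquiv v : Nat.Primes) : ℕ) q = 1 := by
    exact_mod_cast hu'
  exact hq.ne this

end RatPlaces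

/-! ### Norm-one points of lattices -/

namespace QuaternionAlgebra

/-- `ℍ⟮K; R; a, b⟯ := ℍ[K, algebraMap R K a, algebraMap R K b]` (file-local notation, as in
`QuaternionCoordOrder`). -/
local notation "ℍ⟮" K "; " R "; " a ", " b "⟯" =>
  QuaternionAlgebra K (algebraMap R K a) (0 : K) (algebraMap R K b)

/-- `ℚ_w`. -/
local notation "K_" w => HeightOneSpectrum.adicCompletion ℚ w

/-- `ℤ_w`. -/
local notation "𝒪_" w => HeightOneSpectrum.adicCompletionIntegers ℚ w

variable (a b : 𝓞 ℚ)

/-- The coordinate functionals of a basis `bQ` of `ℍ[ℚ,a,b]` as linear forms in the standard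
coordinates: `bQ.repr x i = ∑_j Q_ij x_j` with `Q = bQ.toMatrix (1, i, j, k)`. [folklore] -/
theorem repr_eq_sum_toMatrix_mul (bQ : Module.Basis (Fin 4) ℚ ℍ⟮ℚ; 𝓞 ℚ; a, b⟯)
    (x : ℍ⟮ℚ; 𝓞 ℚ; a, b⟯) (i : Fin 4) :
    bQ.repr x i = ∑ j, bQ.toMatrix (_root_.QuaternionAlgebra.basisOneIJK _ _ _) i j *
      ![x.re, x.imI, x.imJ, x.imK] j := by
  have h := (_root_.QuaternionAlgebra.basisOneIJK _ _ _).toMatrix_mulVec_repr bQ x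
  rw [_root_.QuaternionAlgebra.coe_basisOneIJK_repr] at h
  rw [← h]
  rfl

/-- **Norm-one points of a lattice in an indefinite quaternion algebra over `ℚ`** (Kneser's
strong approximation theorem for `H¹`, lattice form; Vignéras III §4 Thm. 4.3, §5 Cor. 5.7).
Let `H = ℍ[ℚ,a,b]` (`a b ≠ 0`) be not totally definite and `Λ ⊂ H` a full `ℤ`-lattice such that
for every prime `p` some `z ∈ Λ₍ₚ₎` has `z z̄ = 1 + 8d` with `|d|_p < 1`. Then some `x ∈ Λ` has
`x x̄ = 1`. [cite: VignerasLNM800, Ch. III §4 Thm. 4.3 and §5 Cor. 5.7] -/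
theorem exists_mem_mul_star_eq_one (ha : a ≠ 0) (hb : b ≠ 0)
    (hdef : ¬ IsTotallyDefinite ℚ ℍ⟮ℚ; 𝓞 ℚ; a, b⟯) {Λ : Submodule ℤ ℍ⟮ℚ; 𝓞 ℚ; a, b⟯}
    (hΛ : IsFullLattice ℍ⟮ℚ; 𝓞 ℚ; a, b⟯ Λ)
    (hloc : ∀ p : ℕ, p.Prime → ∃ z ∈ localAt p Λ, ∃ d : ℚ, padicNorm p d < 1 ∧
      z * star z = algebraMap ℚ ℍ⟮ℚ; 𝓞 ℚ; a, b⟯ (1 + 8 * d)) :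
    ∃ x ∈ Λ, x * star x = 1 := by
  classical
  have hinj := FaithfulSMul.algebraMap_injective (𝓞 ℚ) ℚ
  haveI : IsQuaternionAlgebra ℚ ℍ⟮ℚ; 𝓞 ℚ; a, b⟯ :=
    QuaternionAlgebra.isQuaternionAlgebra_holds ((map_ne_zero_iff _ hinj).mpr ha)
      ((map_ne_zero_iff _ hinj).mpr hb)
  -- a `ℤ`-basis of `Λ` which is a `ℚ`-basis of `H`, and its coordinate functionals
  obtain ⟨bZ⟩ := hΛ.nonempty_basis_fin_four
  haveI := isLocalizedModule_subtype_of_isFullLattice hΛ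
  set bQ : Module.Basis (Fin 4) ℚ ℍ⟮ℚ; 𝓞 ℚ; a, b⟯ :=
    bZ.ofIsLocalizedModule ℚ (nonZeroDivisors ℤ) Λ.subtype with hbQ
  have hbQZ : ∀ i, bQ i = (bZ i : ℍ⟮ℚ; 𝓞 ℚ; a, b⟯) := fun i =>
    bZ.ofIsLocalizedModule_apply ℚ (nonZeroDivisors ℤ) Λ.subtype i
  set Q : Fin 4 → Fin 4 → ℚ := bQ.toMatrix (_root_.QuaternionAlgebra.basisOneIJK _ _ _) with hQ
  have hQrepr : ∀ (x : ℍ⟮ℚ; 𝓞 ℚ; a, b⟯) (i : Fin 4),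
      ∑ j, Q i j * ![x.re, x.imI, x.imJ, x.imK] j = bQ.repr x i :=
    fun x i => (repr_eq_sum_toMatrix_mul a b bQ x i).symm
  -- a common denominator `N` of `Q` and the finite set `S` of places dividing `N`
  set N : ℕ := ∏ i, ∏ j, (Q i j).den with hN
  have hN0 : N ≠ 0 := Finset.prod_ne_zero_iff.mpr fun i _ =>
    Finset.prod_ne_zero_iff.mpr fun j _ => (Q i j).den_nz
  have hdenN : ∀ i j, (Q i j).den ∣ N := fun i j =>
    (Finset.dvd_prod_of_mem (fun j => (Q i j).den) (Finset.mem_univ j)).trans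
      (Finset.dvd_prod_of_mem (fun i => ∏ j, (Q i j).den) (Finset.mem_univ i))
  have hNQ : ∀ i j, ∃ m : ℤ, (m : ℚ) = (N : ℚ) * Q i j := fun i j => by
    obtain ⟨k, hk⟩ := hdenN i j
    refine ⟨k * (Q i j).num, ?_⟩
    rw [hk]; push_cast
    rw [mul_comm ((Q i j).den : ℚ) (k : ℚ), mul_assoc, Rat.den_mul_eq_num]
  set P : HeightOneSpectrum (𝓞 ℚ) → ℕ :=
    fun v => ((Rat.HeightOneSpectrum.primesEquiv v : Nat.Primes) : ℕ) with hP
  have hPprime : ∀ v, (P v).Prime := fun v => (Rat.HeightOneSpectrum.primesEquiv v).2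
  set S : Finset (HeightOneSpectrum (𝓞 ℚ)) :=
    N.primeFactors.attach.image (fun p => (Rat.HeightOneSpectrum.primesEquiv (R := 𝓞 ℚ)).symm
      ⟨p.1, Nat.prime_of_mem_primeFactors p.2⟩) with hS
  have hSc : ∀ v, v ∉ S → ¬ P v ∣ N := by
    intro v hv hdvd
    apply hv
    rw [hS, Finset.mem_image]
    refine ⟨⟨P v, Nat.mem_primeFactors.mpr ⟨hPprime v, hdvd, hN0⟩⟩, Finset.mem_attach _ _, ?_⟩
    rw [Equiv.symm_apply_eq]
    exact Subtype.ext rfl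
  -- `Q` is integral outside `S`
  have hQS : ∀ v, v ∉ S → ∀ i j, algebraMap ℚ (K_ v) (Q i j) ∈ 𝒪_ v := by
    intro v hv i j
    haveI : Fact (P v).Prime := ⟨hPprime v⟩
    rw [algebraMap_mem_adicCompletionIntegers_iff]
    obtain ⟨m, hm⟩ := hNQ i j
    have hQeq : Q i j = (m : ℚ) / N := by
      rw [hm, mul_div_cancel_left₀ _ (Nat.cast_ne_zero.mpr hN0)]
    rw [hQeq, padicNorm.div, show padicNorm (P v) (N : ℚ) = 1 from
      (padicNorm.nat_eq_one_iff N).mpr (hSc v hv), div_one]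
    exact padicNorm.of_int m
  -- local norm-one points of `Λ_v` at the places of `S` (indeed at all places)
  have hdata : ∀ v : HeightOneSpectrum (𝓞 ℚ), ∃ (z : ℍ⟮ℚ; 𝓞 ℚ; a, b⟯) (s : (𝒪_ v)ˣ),
      z ∈ localAt (P v) Λ ∧
      toAdicCompletion a b v z * star (toAdicCompletion a b v z) =
        algebraMap (K_ v) _ (((s : 𝒪_ v) : K_ v) ^ 2) := by
    intro v
    obtain ⟨z, hz, d, hd, hzd⟩ := hloc (P v) (hPprime v)
    obtain ⟨hdO, hdm⟩ := algebraMap_mem_maximalIdeal_of_padicNorm_lt v d hd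
    obtain ⟨s, hs⟩ := exists_sq_eq_one_add_eight_mul hdm
    have hsu : IsUnit s := by
      by_contra hns
      have hsm : s ∈ IsLocalRing.maximalIdeal (𝒪_ v) := (IsLocalRing.mem_maximalIdeal _).mpr hns
      have h1 : (1 : 𝒪_ v) ∈ IsLocalRing.maximalIdeal (𝒪_ v) := by
        have h : (1 : 𝒪_ v) = s ^ 2 - 8 * ⟨_, hdO⟩ := by rw [hs]; ring
        rw [h, pow_two]
        exact sub_mem (Ideal.mul_mem_left _ _ hsm) (Ideal.mul_mem_left _ _ hdm)
      exact (IsLocalRing.maximalIdeal.isMaximal (𝒪_ v)).ne_top ((Ideal.eq_top_iff_one _).mpr h1)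
    refine ⟨z, hsu.unit, hz, ?_⟩
    rw [← toAdicCompletion_star, ← map_mul, hzd, AlgHom.commutes,
      IsScalarTower.algebraMap_apply ℚ (K_ v) ℍ⟮K_ v; 𝒪_ v; algebraMap (𝓞 ℚ) (𝒪_ v) a,
        algebraMap (𝓞 ℚ) (𝒪_ v) b⟯]
    congr 1
    rw [IsUnit.unit_spec]
    have h := congrArg (algebraMap (𝒪_ v) (K_ v)) hs
    rw [map_pow, map_add, map_one, map_mul, map_ofNat] at h
    rw [map_add, map_one, map_mul, map_ofNat]
    exact h.symm
  choose z s hz hzs using hdata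
  set y : ∀ v : HeightOneSpectrum (𝓞 ℚ),
      ℍ⟮K_ v; 𝒪_ v; algebraMap (𝓞 ℚ) (𝒪_ v) a, algebraMap (𝓞 ℚ) (𝒪_ v) b⟯ :=
    fun v => ((((s v)⁻¹ : (𝒪_ v)ˣ) : 𝒪_ v) : K_ v) • toAdicCompletion a b v (z v) with hy
  have hsinv : ∀ v, ((((s v)⁻¹ : (𝒪_ v)ˣ) : 𝒪_ v) : K_ v) * ((s v : 𝒪_ v) : K_ v) = 1 := fun v => by
    have h := congrArg (fun t : 𝒪_ v => (t : K_ v)) (s v).inv_mul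
    push_cast at h
    exact h
  have hy1 : ∀ v ∈ S, y v * star (y v) = 1 := by
    intro v _
    rw [hy]
    simp only
    rw [_root_.QuaternionAlgebra.star_smul, smul_mul_smul_comm, hzs v, Algebra.smul_def, ← map_mul]
    rw [show ((((s v)⁻¹ : (𝒪_ v)ˣ) : 𝒪_ v) : K_ v) * ((((s v)⁻¹ : (𝒪_ v)ˣ) : 𝒪_ v) : K_ v) *
        ((s v : 𝒪_ v) : K_ v) ^ 2 = ((((( s v)⁻¹ : (𝒪_ v)ˣ) : 𝒪_ v) : K_ v) * ((s v : 𝒪_ v) : K_ v)) ^ 2 by ring,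
      hsinv, one_pow, map_one]
  have hyL : ∀ v ∈ S, ∀ i, ∑ j, algebraMap ℚ (K_ v) (Q i j) *
      ![(y v).re, (y v).imI, (y v).imJ, (y v).imK] j ∈ 𝒪_ v := by
    intro v _ i
    have hre : (y v).re = ((((s v)⁻¹ : (𝒪_ v)ˣ) : 𝒪_ v) : K_ v) * algebraMap ℚ (K_ v) (z v).re := by
      simp only [hy, _root_.QuaternionAlgebra.re_smul, smul_eq_mul, toAdicCompletion_apply]
    have himI : (y v).imI = ((((s v)⁻¹ : (𝒪_ v)ˣ) : 𝒪_ v) : K_ v) * algebraMap ℚ (K_ v) (z v).imI := by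
      simp only [hy, _root_.QuaternionAlgebra.imI_smul, smul_eq_mul, toAdicCompletion_apply]
    have himJ : (y v).imJ = ((((s v)⁻¹ : (𝒪_ v)ˣ) : 𝒪_ v) : K_ v) * algebraMap ℚ (K_ v) (z v).imJ := by
      simp only [hy, _root_.QuaternionAlgebra.imJ_smul, smul_eq_mul, toAdicCompletion_apply]
    have himK : (y v).imK = ((((s v)⁻¹ : (𝒪_ v)ˣ) : 𝒪_ v) : K_ v) * algebraMap ℚ (K_ v) (z v).imK := by
      simp only [hy, _root_.QuaternionAlgebra.imK_smul, smul_eq_mul, toAdicCompletion_apply]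
    have hsum : ∑ j, algebraMap ℚ (K_ v) (Q i j) * ![(y v).re, (y v).imI, (y v).imJ, (y v).imK] j =
        ((((s v)⁻¹ : (𝒪_ v)ˣ) : 𝒪_ v) : K_ v) * algebraMap ℚ (K_ v) (bQ.repr (z v) i) := by
      rw [← hQrepr (z v) i]
      simp only [Fin.sum_univ_four, Matrix.cons_val_zero, Matrix.cons_val_one, Matrix.head_cons,
        Matrix.cons_val_two, Matrix.tail_cons, Matrix.cons_val_three, hre, himI, himJ, himK,
        map_add, map_mul]
      ring
    rw [hsum]
    refine mul_mem (SetLike.coe_mem _) ?_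
    rw [algebraMap_mem_adicCompletionIntegers_iff]
    exact (mem_localAt_iff_forall_padicNorm_repr_le bZ bQ hbQZ (hPprime v) (z v)).mp (hz v) i
  -- strong approximation
  obtain ⟨x, hx1, hxi⟩ := exists_mul_star_eq_one_forall_linear_mem a b ha hb hdef S Q (N : 𝓞 ℚ)
    (by exact_mod_cast hN0)
    (fun i j => by
      obtain ⟨m, hm⟩ := hNQ i j
      exact ⟨m, by rw [map_intCast, map_natCast, hm]⟩)
    hQS y hy1 hyL
  refine ⟨x, ?_, hx1⟩
  refine (mem_iff_forall_exists_intCast_eq_repr bZ bQ hbQZ x).mpr fun i => ?_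
  obtain ⟨r, hr⟩ := hxi i
  obtain ⟨m, rfl⟩ := Rat.int_algebraMap_surjective (R := 𝓞 ℚ) r
  refine ⟨m, ?_⟩
  rw [← hQrepr x i, ← hr, ← IsScalarTower.algebraMap_apply, eq_intCast]

end QuaternionAlgebra

end Literature.NumberTheory.Automorphic
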